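import Summits.QuantumFields.YangMills.Theorems.ConvexGribovBodyCovarianceBoundDefs
import Summits.QuantumFields.YangMills.Theorems.ConvexGribovBodyCovarianceBoundDefsB
import Summits.QuantumFields.YangMills.Theorems.ConvexGribovBodyCovarianceBoundStubSymmBorelCaratheodory
import Summits.QuantumFields.YangMills.Theorems.ConvexGribovBodyCovarianceBoundStubSupMeasurable
import Summits.QuantumFields.YangMills.Theorems.ConvexGribovBodyCovarianceBoundStubSinLeCos
import Summits.QuantumFields.YangMills.Theorems.ConvexGribovBodyCovarianceBoundStubModeReduction
import Summits.QuantumFields.YangMills.Theorems.ConvexGribovBodyCovarianceBoundStubProjSplit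
import Summits.QuantumFields.YangMills.Theorems.ConvexGribovBodyCovarianceBoundStubProjComponents
import Summits.QuantumFields.YangMills.Theorems.ConvexGribovBodyCovarianceBoundStubLieAlgPerfect
import Summits.QuantumFields.YangMills.Theorems.ConvexGribovBodyCovarianceBoundStubSupportLie
import HarnessLib

/-!
# `CovarianceBound` reduced to two Lee–Yang windows (crux stmt-QuantumFields-8780, line `Sketch`)

Route `QuantumFields/YangMills/ConvexGribovBody`, crux
`Summit.QuantumFields.YangMills.Theses.ConvexGribovBody.CovarianceBound` (volume-uniform bound on the
minimal-Coulomb-gauge equal-time gluon covariance of lattice Yang–Mills on `(2S+1)⁴`, every compact simple `G`,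
every faithful unitary `r`, `β ≥ β₀`, `S ≥ S₀(β)`, all spatial momenta).

This file is the sorry-free COMPOSITION of the skeleton line `Sketch` (support slope × response window,
`𝔤/𝔤^⊥` split; `Cruxes/CovarianceBound/Lines/Sketch.lean` v6): it states the two route-posited measure-side
inputs that remain open —

* `ZeroFreeWindowLie`: for a measurable absolute-Coulomb-minimiser selection attaining `sup ‖P_𝔤 Ĉ_j(p)‖²_F`,
  every real component `X` of the `𝔤`-part of the mid-link cosine mode has a symmetrised Laplace transform
  `E e^{zX} + E e^{−zX}` without zeros on `‖z‖ < c·irScale = c·√(p̂² + (2π/L)²)` (the Gribov–Zwanziger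
  infrared statement in Lee–Yang form; the radius is the sharp Maas–Zwanziger scale by Borel–Carathéodory);
* `ZeroFreeWindowPerp`: the same for the `𝔤^⊥`-part with a volume-independent radius, or that part vanishes —

and proves `covarianceBound_of_zeroFreeWindows : ZeroFreeWindowLie → ZeroFreeWindowPerp → CovarianceBound`
from the landed stubs of the line: minimisers/measurability/a-priori bounds (`stub_supMeasurable`), the exact
mode reduction `‖Â_j‖² = ‖Ĉ_j‖² + ‖Ŝ_j‖²` and component bookkeeping (`stub_modeReduction`,
`stub_projSplit`, `stub_projComponents`), `∫ sup‖Ŝ_j‖² ≤ 4 ∫ sup‖Ĉ_j‖²` by translation invariance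
(`stub_sinLeCos`), the symmetrised Borel–Carathéodory second-moment bound `E X² ≤ κ M / R`
(`stub_symmBorelCaratheodory`), perfectness of `𝔤` (`stub_lieAlgPerfect`) and Zwanziger's Gribov-region
support bound for the `𝔤`-part (`stub_supportLie`). The constant is `D = 60 N² κ (√C/c + (√N+1)/c') + 1`.

Design: the two windows are `def … : Prop` (route-posited statements, not literature facts: nothing in print
proves them for any non-abelian `G`); the theorem is CONDITIONAL on them and does not close the crux. It is the
glue for promoting the windows to items (`C₁ → C₂ → C`).
-/

set_option autoImplicit false

noncomputable section

namespace Summit.QuantumFields.YangMills.Cruxes.CovarianceBound.SupportWindow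

open scoped BigOperators Topology Classical MeasureTheory ProbabilityTheory Matrix ComplexConjugate
open Filter Set Function TopologicalSpace MeasureTheory
open Literature.MathematicalPhysics.QuantumFieldTheory

/-! ### The two open measure-side inputs (route-posited statements) -/

/-- **Zero-free window for the `𝔤`-components** (route-posited, OPEN): for every compact simple `G` and
faithful unitary `r` there is `β₀` such that for `β ≥ β₀` there are `c > 0` and `S₀` with: on every torus
`(2S+1)⁴`, `S ≥ S₀`, for every spatial momentum `p` and polarisation `j`, some measurable selection `sel` of
absolute lattice Coulomb minimisers attaining `sup ‖P_𝔤 Ĉ_j(p)‖²_F` makes every real component `X` of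
`P_𝔤 Ĉ_j(p; U, sel U)` satisfy `∫ e^{zX} dμ_β + ∫ e^{−zX} dμ_β ≠ 0` for `‖z‖ < c·irScale S p`
(`irScale² = p̂² + (2π/(2S+1))²`). Physically: no Lee–Yang zero of the field tilted by the gauge-fixed gluon
mode closer than the Maas–Zwanziger non-analyticity scale `∝ |p|` — the Gribov–Zwanziger infrared statement. -/
def ZeroFreeWindowLie : Prop :=
  ∀ (G : Type) [Group G] [TopologicalSpace G] [IsTopologicalGroup G] [CompactSpace G]
    [MeasurableSpace G] [BorelSpace G], IsCompactSimpleLieGroup G → ∀ r : LatticeRep G,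
    ∃ β₀ : ℝ, ∀ β : ℝ, β₀ ≤ β → ∃ c : ℝ, 0 < c ∧ ∃ S₀ : ℕ, ∀ S : ℕ, S₀ ≤ S →
      ∀ (p : Fin 3 → ZMod (2 * S + 1)) (j : Fin 3),
        ∃ sel : GaugeConfig 4 (2 * S + 1) G → (Site 4 (2 * S + 1) → G),
          Measurable sel ∧ (∀ U, IsCoulMin r S U (sel U)) ∧
          (∀ U, froSq (lieCosMode r S p j U (sel U)) = supLieCosSq r S p j U) ∧
          ∀ (a b : Fin r.N) (q : Bool) (z : ℂ), ‖z‖ < c * irScale S p →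
            (∫ U, Complex.exp (z * (lieCosComp r S p j a b q sel U : ℂ)) ∂(wilson4 r β S)) +
              (∫ U, Complex.exp (-(z * (lieCosComp r S p j a b q sel U : ℂ))) ∂(wilson4 r β S)) ≠ 0

/-- **Zero-free window for the `𝔤^⊥`-components** (route-posited, OPEN): as `ZeroFreeWindowLie` for the
components of `Ĉ_j(p) − P_𝔤 Ĉ_j(p)` (trace part for `SU(N ≥ 3)`, higher harmonics for non-fundamental `ρ`),
with a VOLUME-INDEPENDENT radius `c`; the first disjunct covers the case in which the `𝔤^⊥`-part vanishes at
every minimiser (e.g. `SU(2)` fundamental, where `½(W − Wᴴ) ∈ 𝔰𝔲(2)` exactly). Physically: analyticity near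
the origin, uniformly in the volume, of the free energy tilted by the dimension-3 gauge-fixed composite
`Σ_y cos(…)(A − P_𝔤 A)_j(y)`. -/
def ZeroFreeWindowPerp : Prop :=
  ∀ (G : Type) [Group G] [TopologicalSpace G] [IsTopologicalGroup G] [CompactSpace G]
    [MeasurableSpace G] [BorelSpace G], IsCompactSimpleLieGroup G → ∀ r : LatticeRep G,
    ∃ β₀ : ℝ, ∀ β : ℝ, β₀ ≤ β → ∃ c : ℝ, 0 < c ∧ ∃ S₀ : ℕ, ∀ S : ℕ, S₀ ≤ S →
      ∀ (p : Fin 3 → ZMod (2 * S + 1)) (j : Fin 3),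
        (∀ U : GaugeConfig 4 (2 * S + 1) G, supPerpCosSq r S p j U = 0) ∨
        ∃ sel : GaugeConfig 4 (2 * S + 1) G → (Site 4 (2 * S + 1) → G),
          Measurable sel ∧ (∀ U, IsCoulMin r S U (sel U)) ∧
          (∀ U, froSq (perpCosMode r S p j U (sel U)) = supPerpCosSq r S p j U) ∧
          ∀ (a b : Fin r.N) (q : Bool) (z : ℂ), ‖z‖ < c →
            (∫ U, Complex.exp (z * (perpCosComp r S p j a b q sel U : ℂ)) ∂(wilson4 r β S)) +
              (∫ U, Complex.exp (-(z * (perpCosComp r S p j a b q sel U : ℂ))) ∂(wilson4 r β S)) ≠ 0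

/-! ### The composition -/

/-- One Borel–Carathéodory application, packaged: a measurable real observable with `X² ≤ B²` pointwise
(`0 < B`) and a symmetrised transform zero-free on `‖z‖ < 2R` has `∫ X² ≤ κ B / R`. -/
theorem secondMoment_le_of_zeroFree {κ : ℝ} (hBC : ∀ (Ω : Type) [MeasurableSpace Ω] (P : Measure Ω) [IsProbabilityMeasure P]
      (X : Ω → ℝ) (M R : ℝ), 0 < M → 0 < R → Measurable X → (∀ ω, |X ω| ≤ M) →
      (∀ z : ℂ, ‖z‖ < 2 * R →
        (∫ ω, Complex.exp (z * (X ω : ℂ)) ∂P) + (∫ ω, Complex.exp (-(z * (X ω : ℂ))) ∂P) ≠ 0) →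
      ∫ ω, (X ω) ^ 2 ∂P ≤ κ * M / R)
    {Ω : Type} [MeasurableSpace Ω] (P : Measure Ω) [IsProbabilityMeasure P] (X : Ω → ℝ) {B R : ℝ}
    (hB : 0 < B) (hR : 0 < R) (hX : Measurable X) (hXB : ∀ ω, (X ω) ^ 2 ≤ B ^ 2)
    (hzero : ∀ z : ℂ, ‖z‖ < 2 * R →
      (∫ ω, Complex.exp (z * (X ω : ℂ)) ∂P) + (∫ ω, Complex.exp (-(z * (X ω : ℂ))) ∂P) ≠ 0) :
    ∫ ω, (X ω) ^ 2 ∂P ≤ κ * B / R :=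
  hBC Ω P X B R hB hR hX (fun ω => abs_le_of_sq_le_sq' (hXB ω) hB.le |>.elim fun h1 h2 => abs_le.2 ⟨h1, h2⟩)
    hzero

/-- **`CovarianceBound` from the two zero-free windows.** If `ZeroFreeWindowLie` and `ZeroFreeWindowPerp`
hold then `Summit.QuantumFields.YangMills.Theses.ConvexGribovBody.CovarianceBound` holds, with
`β₀ = max β₁ β₂`, `S₀ = max S₁ S₂` and `D = 60 N² κ (√C/c + (√N+1)/c') + 1` (`κ` the Borel–Carathéodory
constant, `C` Zwanziger's support constant, `c, c'` the window radii). Proof: mode reduction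
`∫ sup cov ≤ L⁻³ Σ_j (∫ sup‖Ĉ_j‖² + ∫ sup‖Ŝ_j‖²)`, `∫ sup‖Ŝ_j‖² ≤ 4 ∫ sup‖Ĉ_j‖²`, orthogonal split
`sup‖Ĉ_j‖² ≤ sup‖P_𝔤Ĉ_j‖² + sup‖P_⊥Ĉ_j‖²`, each sup written as the sum of its `2N²` component second moments
in the window's selection, and Borel–Carathéodory per component with support `M = √C L³ irScale`
(resp. `√N L³ + 1`) and radius `c·irScale/2` (resp. `c'/2`) — the factors `irScale` and `L³` cancel. -/
theorem covarianceBound_of_zeroFreeWindows :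
    ZeroFreeWindowLie → ZeroFreeWindowPerp →
      Summit.QuantumFields.YangMills.Theses.ConvexGribovBody.CovarianceBound := by
  intro hwinL hwinP
  -- landed stubs (waves 1–2 of lead 8780-0), used as theorems
  have hmeas := stub_supMeasurable
  have hsin := stub_sinLeCos
  have hbc := stub_symmBorelCaratheodory
  have hred := stub_modeReduction
  have hsplit := stub_projSplit
  have hcomp := stub_projComponents
  have hF1 := stub_lieAlgPerfect
  have hsupp := stub_supportLie
  rw [covarianceBound_iff]
  intro G _ _ _ _ _ _ hG r
  obtain ⟨C, hC, hCsupp⟩ := hsupp G hG r (hF1 G hG r)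
  obtain ⟨κ, hκ, hBC⟩ := hbc
  obtain ⟨β₁, hβ₁⟩ := hwinL G hG r
  obtain ⟨β₂, hβ₂⟩ := hwinP G hG r
  refine ⟨max β₁ β₂, fun β hβ => ?_⟩
  obtain ⟨c, hc, S₁, hS₁⟩ := hβ₁ β (le_trans (le_max_left _ _) hβ)
  obtain ⟨c', hc', S₂, hS₂⟩ := hβ₂ β (le_trans (le_max_right _ _) hβ)
  set N : ℕ := r.N with hN
  refine ⟨60 * (N : ℝ) ^ 2 * κ * (Real.sqrt C / c + (Real.sqrt N + 1) / c') + 1, by positivity, max S₁ S₂,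
    fun S hS p => ?_⟩
  have hS1 : S₁ ≤ S := le_trans (le_max_left _ _) hS
  have hS2 : S₂ ≤ S := le_trans (le_max_right _ _) hS
  set L : ℝ := (2 * S + 1 : ℝ) with hL
  have hLpos : 0 < L := by rw [hL]; positivity
  have hL3 : 0 < L ^ 3 := by positivity
  change ∫ U, supCov r S p U ∂(wilson4 r β S) ≤ _
  set μ := wilson4 r β S with hμ
  -- stub 2
  have hM := fun j => hmeas G r S p j
  have hex : ∀ U : GaugeConfig 4 (2 * S + 1) G, ∃ h, IsCoulMin r S U h := (hM 0).1
  have hbounds : ∀ (j : Fin 3) (U : GaugeConfig 4 (2 * S + 1) G) (h : Site 4 (2 * S + 1) → G),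
      (0 ≤ modeCov r S U h p ∧ modeCov r S U h p ≤ 3 * r.N * (2 * S + 1 : ℝ) ^ 3) ∧
      froSq (cosMode r S p j U h) ≤ r.N * (2 * S + 1 : ℝ) ^ 6 ∧
      froSq (sinMode r S p j U h) ≤ r.N * (2 * S + 1 : ℝ) ^ 6 := fun j => (hM j).2.1
  have hmC : Measurable (supCov r S p) := (hM 0).2.2.1
  have hmCos : ∀ j, Measurable (supCosSq r S p j) := fun j => (hM j).2.2.2.1
  have hmSin : ∀ j, Measurable (supSinSq r S p j) := fun j => (hM j).2.2.2.2.1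
  have hsupb := fun j => (hM j).2.2.2.2.2
  have hcosb : ∀ (j : Fin 3) (U : GaugeConfig 4 (2 * S + 1) G) (h : Site 4 (2 * S + 1) → G),
      IsCoulMin r S U h → froSq (cosMode r S p j U h) ≤ r.N * (2 * S + 1 : ℝ) ^ 6 :=
    fun j U h _ => (hbounds j U h).2.1
  -- stub 4 (A),(B)
  obtain ⟨hred1, hred0, -⟩ := hred G r β S p hex hbounds hmC hmCos hmSin
  -- sine ≤ 4 cosine
  have hsc : ∀ j : Fin 3, ∫ U, supSinSq r S p j U ∂μ ≤ 4 * ∫ U, supCosSq r S p j U ∂μ := by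
    intro j
    by_cases hp : p = 0
    · have h0 : (fun U => supSinSq r S p j U) = fun _ => (0 : ℝ) := funext fun U => hred0 hp j U
      have hnn : 0 ≤ ∫ U, supCosSq r S p j U ∂μ := integral_nonneg fun U => ((hsupb j) U).2.1.1
      calc ∫ U, supSinSq r S p j U ∂μ = 0 := by rw [h0]; simp
        _ ≤ 4 * ∫ U, supCosSq r S p j U ∂μ := by linarith
    · exact hsin G r β S p j hp hex (fun U h => ⟨(hbounds j U h).2.1, (hbounds j U h).2.2⟩)
        (hmCos j) (hmSin j)
  -- projected split (stub P1)
  have hP := fun j => hsplit G r S p j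
  -- selections from the two windows
  choose selL hselLm hselLmin hselLsup hselLwin using fun j => hS₁ S hS1 p j
  have hirr : 0 < irScale S p := irScale_pos S p
  have hsqC : 0 < Real.sqrt C := Real.sqrt_pos.2 hC
  have hNpos' : (0 : ℝ) ≤ (N : ℝ) := by positivity
  -- Lie components: second moments
  set ML : ℝ := Real.sqrt C * L ^ 3 * irScale S p with hML
  have hMLpos : 0 < ML := by positivity
  set RL : ℝ := c * irScale S p / 2 with hRL
  have hRLpos : 0 < RL := by positivity
  have hcompL : ∀ (j : Fin 3) (a b : Fin r.N) (q : Bool),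
      ∫ U, (lieCosComp r S p j a b q (selL j) U) ^ 2 ∂μ ≤ κ * ML / RL := by
    intro j a b q
    obtain ⟨-, hmeasc, hdom⟩ := (hcomp G r β S p j (selL j) (hselLm j) (hselLmin j) (hcosb j)).1
      (hselLsup j) (hP j).2.1
    refine secondMoment_le_of_zeroFree hBC μ (lieCosComp r S p j a b q (selL j)) hMLpos hRLpos (hmeasc a b q) ?_ ?_
    · intro U
      have h1 := hdom a b q U
      have h2 := hCsupp S U (selL j U) (hselLmin j U) p j
      calc (lieCosComp r S p j a b q (selL j) U) ^ 2
          ≤ froSq (lieCosMode r S p j U (selL j U)) := h1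
        _ ≤ C * (2 * S + 1 : ℝ) ^ 6 * (latMomSq S p + (2 * Real.pi / (2 * S + 1)) ^ 2) := h2
        _ = ML ^ 2 := by
            rw [hML, mul_pow, mul_pow, Real.sq_sqrt hC.le, irScale_sq]; ring
    · intro z hz
      have hz' : ‖z‖ < c * irScale S p := by rw [hRL] at hz; linarith
      exact hselLwin j a b q z hz'
  -- Perp components: second moments (trivial support √N L³)
  set MP : ℝ := Real.sqrt N * L ^ 3 + 1 with hMP
  have hMPpos : 0 < MP := by positivity
  set RP : ℝ := c' / 2 with hRP
  have hRPpos : 0 < RP := by positivity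
  have hPbound : ∀ j : Fin 3, ∫ U, supPerpCosSq r S p j U ∂μ ≤ 2 * (N : ℝ) ^ 2 * (κ * MP / RP) := by
    intro j
    rcases hS₂ S hS2 p j with hzero | ⟨selP, hselPm, hselPmin, hselPsup, hselPwin⟩
    · have h0 : (fun U => supPerpCosSq r S p j U) = fun _ => (0 : ℝ) := funext hzero
      have hz : ∫ U, supPerpCosSq r S p j U ∂μ = 0 := by rw [h0]; simp
      rw [hz]; positivity
    · have hcompP : ∀ (a b : Fin r.N) (q : Bool),
          ∫ U, (perpCosComp r S p j a b q selP U) ^ 2 ∂μ ≤ κ * MP / RP := by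
        intro a b q
        obtain ⟨-, hmeasc, hdom⟩ := (hcomp G r β S p j selP hselPm hselPmin (hcosb j)).2
          hselPsup (hP j).2.2.1
        refine secondMoment_le_of_zeroFree hBC μ (perpCosComp r S p j a b q selP) hMPpos hRPpos (hmeasc a b q) ?_ ?_
        · intro U
          have h1 := hdom a b q U
          have hsplitU := (hP j).1 U (selP U)
          have h3 := hcosb j U (selP U) (hselPmin U)
          have hnnL : 0 ≤ froSq (lieCosMode r S p j U (selP U)) := by
            unfold froSq; exact Finset.sum_nonneg fun a _ => Finset.sum_nonneg fun b _ => by positivity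
          have h4 : froSq (perpCosMode r S p j U (selP U)) ≤ r.N * (2 * S + 1 : ℝ) ^ 6 := by linarith
          have h5 : (r.N : ℝ) * (2 * S + 1 : ℝ) ^ 6 ≤ MP ^ 2 := by
            have hsq : Real.sqrt (N : ℝ) ^ 2 = (N : ℝ) := Real.sq_sqrt hNpos'
            have hNN : (r.N : ℝ) = (N : ℝ) := by rw [hN]
            have hL6 : (2 * S + 1 : ℝ) ^ 6 = L ^ 3 * L ^ 3 := by rw [hL]; ring
            rw [hNN, hL6, hMP]
            nlinarith [hsq, hL3, Real.sqrt_nonneg (N : ℝ), mul_nonneg (Real.sqrt_nonneg (N : ℝ)) hL3.le]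
          calc (perpCosComp r S p j a b q selP U) ^ 2
              ≤ froSq (perpCosMode r S p j U (selP U)) := h1
            _ ≤ MP ^ 2 := by linarith [h4, h5]
        · intro z hz
          have hz' : ‖z‖ < c' := by rw [hRP] at hz; linarith
          exact hselPwin a b q z hz'
      obtain ⟨hsumP, -, -⟩ := (hcomp G r β S p j selP hselPm hselPmin (hcosb j)).2 hselPsup (hP j).2.2.1
      rw [hsumP]
      calc ∑ a : Fin r.N, ∑ b : Fin r.N, ∑ q : Bool, ∫ U, (perpCosComp r S p j a b q selP U) ^ 2 ∂μ
          ≤ ∑ a : Fin r.N, ∑ b : Fin r.N, ∑ q : Bool, κ * MP / RP :=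
            Finset.sum_le_sum fun a _ => Finset.sum_le_sum fun b _ =>
              Finset.sum_le_sum fun q _ => hcompP a b q
        _ = 2 * (N : ℝ) ^ 2 * (κ * MP / RP) := by
            simp only [Finset.sum_const, Finset.card_univ, Fintype.card_bool, Fintype.card_fin, hN]
            ring
  -- assemble per polarisation
  have hκL : κ * ML / RL = 2 * κ * Real.sqrt C * L ^ 3 / c := by rw [hML, hRL]; field_simp
  have hκP : κ * MP / RP = 2 * κ * MP / c' := by rw [hRP]; field_simp
  have hcosj : ∀ j : Fin 3, ∫ U, supCosSq r S p j U ∂μ ≤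
      2 * (N : ℝ) ^ 2 * (κ * ML / RL) + 2 * (N : ℝ) ^ 2 * (κ * MP / RP) := by
    intro j
    -- supCos ≤ supLie + supPerp, integrate
    have hPj := hP j
    have hle : ∀ U, supCosSq r S p j U ≤ supLieCosSq r S p j U + supPerpCosSq r S p j U :=
      fun U => ((hPj.2.2.2 U (hcosb j U))).2.2.2.2
    have hbL : ∀ U, 0 ≤ supLieCosSq r S p j U ∧ supLieCosSq r S p j U ≤ r.N * (2 * S + 1 : ℝ) ^ 6 :=
      fun U => ⟨(hPj.2.2.2 U (hcosb j U)).1, (hPj.2.2.2 U (hcosb j U)).2.1⟩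
    have hbP : ∀ U, 0 ≤ supPerpCosSq r S p j U ∧ supPerpCosSq r S p j U ≤ r.N * (2 * S + 1 : ℝ) ^ 6 :=
      fun U => ⟨(hPj.2.2.2 U (hcosb j U)).2.2.1, (hPj.2.2.2 U (hcosb j U)).2.2.2.1⟩
    have hintL : Integrable (supLieCosSq r S p j) μ := by
      refine Integrable.of_bound (hPj.2.1).aestronglyMeasurable (r.N * (2 * S + 1 : ℝ) ^ 6) ?_
      exact Filter.Eventually.of_forall fun U => by
        rw [Real.norm_eq_abs, abs_of_nonneg (hbL U).1]; exact (hbL U).2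
    have hintP : Integrable (supPerpCosSq r S p j) μ := by
      refine Integrable.of_bound (hPj.2.2.1).aestronglyMeasurable (r.N * (2 * S + 1 : ℝ) ^ 6) ?_
      exact Filter.Eventually.of_forall fun U => by
        rw [Real.norm_eq_abs, abs_of_nonneg (hbP U).1]; exact (hbP U).2
    have hintC : Integrable (supCosSq r S p j) μ := by
      refine Integrable.of_bound (hmCos j).aestronglyMeasurable (r.N * (2 * S + 1 : ℝ) ^ 6) ?_
      exact Filter.Eventually.of_forall fun U => by
        rw [Real.norm_eq_abs, abs_of_nonneg ((hsupb j) U).2.1.1]; exact ((hsupb j) U).2.1.2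
    have hstep : ∫ U, supCosSq r S p j U ∂μ ≤
        (∫ U, supLieCosSq r S p j U ∂μ) + ∫ U, supPerpCosSq r S p j U ∂μ := by
      rw [← integral_add hintL hintP]
      exact integral_mono hintC (hintL.add hintP) hle
    obtain ⟨hsumL, -, -⟩ := (hcomp G r β S p j (selL j) (hselLm j) (hselLmin j) (hcosb j)).1
      (hselLsup j) hPj.2.1
    have hL' : ∫ U, supLieCosSq r S p j U ∂μ ≤ 2 * (N : ℝ) ^ 2 * (κ * ML / RL) := by
      rw [hsumL]
      calc ∑ a : Fin r.N, ∑ b : Fin r.N, ∑ q : Bool, ∫ U, (lieCosComp r S p j a b q (selL j) U) ^ 2 ∂μ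
          ≤ ∑ a : Fin r.N, ∑ b : Fin r.N, ∑ q : Bool, κ * ML / RL :=
            Finset.sum_le_sum fun a _ => Finset.sum_le_sum fun b _ =>
              Finset.sum_le_sum fun q _ => hcompL j a b q
        _ = 2 * (N : ℝ) ^ 2 * (κ * ML / RL) := by
            simp only [Finset.sum_const, Finset.card_univ, Fintype.card_bool, Fintype.card_fin, hN]
            ring
    have hP' := hPbound j
    linarith
  have hjsum : ∀ j : Fin 3, (∫ U, supCosSq r S p j U ∂μ) + ∫ U, supSinSq r S p j U ∂μ ≤
      5 * (2 * (N : ℝ) ^ 2 * (κ * ML / RL) + 2 * (N : ℝ) ^ 2 * (κ * MP / RP)) := by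
    intro j
    have h1 := hsc j
    have h2 := hcosj j
    have hnn : 0 ≤ ∫ U, supCosSq r S p j U ∂μ := integral_nonneg fun U => ((hsupb j) U).2.1.1
    nlinarith
  have htot : ∫ U, supCov r S p U ∂μ ≤
      (1 / L ^ 3) * (3 * (5 * (2 * (N : ℝ) ^ 2 * (κ * ML / RL) + 2 * (N : ℝ) ^ 2 * (κ * MP / RP)))) := by
    refine hred1.trans ?_
    refine mul_le_mul_of_nonneg_left ?_ (by positivity)
    calc ∑ j : Fin 3, ((∫ U, supCosSq r S p j U ∂μ) + ∫ U, supSinSq r S p j U ∂μ)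
        ≤ ∑ j : Fin 3, 5 * (2 * (N : ℝ) ^ 2 * (κ * ML / RL) + 2 * (N : ℝ) ^ 2 * (κ * MP / RP)) :=
          Finset.sum_le_sum fun j _ => hjsum j
      _ = 3 * (5 * (2 * (N : ℝ) ^ 2 * (κ * ML / RL) + 2 * (N : ℝ) ^ 2 * (κ * MP / RP))) := by
          simp only [Finset.sum_const, Finset.card_univ, Fintype.card_fin]
          ring
  rw [hκL, hκP] at htot
  -- final arithmetic: MP = √N L³ + 1 ≤ (√N + 1) L³ and 1/L³ bookkeeping
  have hMPle : MP ≤ (Real.sqrt N + 1) * L ^ 3 := by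
    have h1 : (1 : ℝ) ≤ L := by
      rw [hL]
      have h0 : (0 : ℝ) ≤ 2 * (S : ℝ) := by positivity
      linarith
    have h13 : (1 : ℝ) ≤ L ^ 3 := one_le_pow₀ h1
    rw [hMP]
    nlinarith [Real.sqrt_nonneg (N : ℝ), h13]
  have hkey : (1 / L ^ 3) * (3 * (5 * (2 * (N : ℝ) ^ 2 * (2 * κ * Real.sqrt C * L ^ 3 / c) +
      2 * (N : ℝ) ^ 2 * (2 * κ * MP / c')))) ≤
      60 * (N : ℝ) ^ 2 * κ * (Real.sqrt C / c + (Real.sqrt N + 1) / c') := by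
    have hA : (1 / L ^ 3) * (3 * (5 * (2 * (N : ℝ) ^ 2 * (2 * κ * Real.sqrt C * L ^ 3 / c)))) =
        60 * (N : ℝ) ^ 2 * κ * (Real.sqrt C / c) := by field_simp; ring
    have hB : (1 / L ^ 3) * (3 * (5 * (2 * (N : ℝ) ^ 2 * (2 * κ * MP / c')))) ≤
        60 * (N : ℝ) ^ 2 * κ * ((Real.sqrt N + 1) / c') := by
      have h1 : (1 / L ^ 3) * (3 * (5 * (2 * (N : ℝ) ^ 2 * (2 * κ * MP / c')))) =
          60 * (N : ℝ) ^ 2 * κ * (MP / L ^ 3) / c' := by field_simp; ring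
      rw [h1]
      have h2 : MP / L ^ 3 ≤ Real.sqrt N + 1 := by
        rw [div_le_iff₀ hL3]; exact hMPle
      have h3 : 0 ≤ 60 * (N : ℝ) ^ 2 * κ := by positivity
      calc 60 * (N : ℝ) ^ 2 * κ * (MP / L ^ 3) / c'
          = 60 * (N : ℝ) ^ 2 * κ * ((MP / L ^ 3) / c') := by ring
        _ ≤ 60 * (N : ℝ) ^ 2 * κ * ((Real.sqrt N + 1) / c') :=
            mul_le_mul_of_nonneg_left (div_le_div_of_nonneg_right h2 hc'.le) h3
    calc _ = (1 / L ^ 3) * (3 * (5 * (2 * (N : ℝ) ^ 2 * (2 * κ * Real.sqrt C * L ^ 3 / c)))) +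
          (1 / L ^ 3) * (3 * (5 * (2 * (N : ℝ) ^ 2 * (2 * κ * MP / c')))) := by ring
      _ ≤ _ := by rw [hA]; linarith
  linarith [hkey, htot]

end Summit.QuantumFields.YangMills.Cruxes.CovarianceBound.SupportWindow

end
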